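/-
Copyright (c) 2026 the pub-hodgecm-mathlib formalisation cell (harness21).  Prover seat hodgecm-mathlib-LA7-p01 (g3), «GO 500» half A,
organ (S1a) of A-p01 (g28)'s `stub_ESHEET` organ map (LA5-plan (g3) DEAL L5-#3); 2026-09-02.
-/
import Literature.AlgebraicGeometry.AbelianSchemes.SerreTwistExactPolarizationExists
import Literature.AlgebraicGeometry.AbelianSchemes.SerreTwistPolarizationCompatible
import Literature.AlgebraicGeometry.AbelianSchemes.SerreTwistLevel
import Literature.AlgebraicGeometry.AbelianSchemes.SerrePresentationOfKernelLaw
import HarnessLib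

/-!
# The Serre-twisted family `(A ⊗_𝒪 𝔞⁻¹, ι_𝔞, λ_𝔞, η_𝔞)` over a base `X` and its cover `c = ψ_P : A → A ⊗_𝒪 𝔞⁻¹`: the rows (t1)(t1′)(t2)(t3)(t4)(t5)
# ([RapoportSmithlingZhang2020Diagonal] §3.2 ∕ (4.23); [Conrad2004GrossZagier] §7 Thm. 7.5; [MumfordAV1970] §7 Thm. 4, §23 Thm. 2)

Topic `AlgebraicGeometry/AbelianSchemes`, namespace `Literature.AlgebraicGeometry.AbelianSchemes.AbelianSchemeOver`.  THEOREMS ONLY (no definition, no named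
fact, no `instance`, no notation, no `sorry`).  Cell `hodgecm-mathlib` (D-0151), F0∕P6 «MOD», «GO 500» half A, X-LEAF `Lines/F0_P6a_EExports.lean` socket
`stub_ESHEET` («THE SHEET LINE», E-pen A-p01 (g28) memo `MEMO-ESHEET-organs.v1.A-p01g28.md` 66df4d8c), **organ (S1a) «SERRE-TENSORED FAMILY AND ITS COVER OVER
`X`»** (LA5-plan (g3) DEAL L5-#3 → LA7-p01 (g3)); `--supports stmt-HodgeConjecture-24832`, count-neutral.  HONEST LABEL: HC_CM is proved only modulo the 7
printed citations (2 remaining: hLiu418 = stmt-HodgeConjecture-24832, h413 = stmt-HodgeConjecture-24833) until rung 0 closes; this file discharges none of them.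

## Mathematics

`A → S` a commutative abelian scheme over a reduced locally Noetherian base with a ring action `ι : 𝒪 → End_S(A)` (★ `RingAction`), a dual pair `D = (Â, 𝒫)`,
a polarisation `λ` satisfying the Rosati law `ι(σ a) ≫ λ = λ ≫ ι(a)^∨` for an involution-shaped map `σ : 𝒪 → 𝒪`, and a level-`n` structure `η`; `𝔞 ≤ 𝒪` an
ideal PRESENTED à la Serre — `𝔟 = E′·𝒪ᵐ ≅ 𝔞⁻¹` with `E′² = E′`, the column `P ↔ 1 ∈ 𝔞⁻¹` (`E′P = P`, coordinates generating `𝔞`) and a quasi-inverse row `Q`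
(`QE′ = Q`, `QP = N`, `PQ = N·E′`) for a natural number `N ∈ 𝔞`, `N ≠ 0` (★ `Literature.NumberTheory.NumberFields.SerrePresentation.exists_serrePresentation_of_ideal_of_natCast_mem`
for `𝒪 = 𝓞 F`; in the sheet line `N := n_γ` with `(n_γ) = 𝔞_γ𝔞̄_γ`).  The SERRE-TWISTED FAMILY is `A ⊗_𝒪 𝔟` (★ `serreTensor`) with the action `ι_𝔟` (★ `serreAction`),
the COVER is the ideal translation `c := ψ_P : A → A ⊗_𝒪 𝔟` (★ `serreTranslate`, «`A → A ⊗ 𝔞⁻¹`», an fppf isogeny with kernel `A[𝔞]`), and given ANY dual pair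
`D_𝔟` of `A ⊗_𝒪 𝔟` with the unit pin (its existence over a general base is P-2′ ∕ `stub_DUALS` currency and is NOT asserted here — every ★ Serre file takes it as a
parameter):

* (t3) the EXACT twisted polarisation `λ′ : A ⊗ 𝔟 → (A ⊗ 𝔟)^` with `ψ_P ≫ λ′ ≫ ψ_P^∨ = λ ≫ [N]` exists and is unique (★ `exists_isExactTwistPol_of_rosatiPair`, from a
  ROSATI PAIR `1 − a ∈ 𝔞`, `b ∈ 𝔞`, `ι(a) ≫ λ = λ ≫ ι(b)^∨` — in the CM model `a ∈ 𝔞̄`, `b = ā`, available iff `𝔞 + 𝔞̄ = 𝒪`), and it is `𝒪`-compatible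
  (★ `serreAction_i_comp_of_isExactTwistPol`);
* (t5) the twisted level structure `η′` with `η′.σ i = η.σ i ≫ ψ_P` exists and is unique when `(N, n) = 1` (★ `LevelStructure.existsUnique_serreTwist`);
* (t1) `∀ a ∈ 𝔞, ∃ d, ψ_P ≫ d = ι(a) ∧ d ≫ ψ_P = ι_𝔟(a)` (★ `serreTranslate_twoSided_presentation`); (t1′) `t ≫ ψ_P = 1 ↔ ∀ a ∈ 𝔞, t ≫ ι(a) = 1` on all
  `T`-points (★ `comp_serreTranslate_eq_one_iff_forall_mem`) and `ψ_P` is surjective (★ `surjective_serreTranslate_left`); (t4) `ι(a) ≫ ψ_P = ψ_P ≫ ι_𝔟(a)`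
  (★ `i_comp_serreTranslate`);
* (t2) «upper bound through `𝔞̄` and `(N) = 𝔞𝔞̄`»: for every `b` with `b·𝔞 ⊆ (N)` there is `f : A → A ⊗ 𝔟` with `ψ_P ≫ ι_𝔟(b) = f ≫ ι_𝔟(N)` — `f := ψ_{P_b}` for
  the column `P_b := (b·P)∕N ∈ 𝔟` («multiplication by `b∕N ∈ 𝔞⁻¹`»), §1 of this file.

These are the rows (t1)(t1′)(t2)(t3)(t4)(t5) of the E-line reading `CoverKerE` (`Cruxes/HLiu418/Lines/F0_P6a_EReadings.lean` ED. 3 :778) OVER THE BASE `X`; their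
point versions follow by ★ base change ((S4) of the organ map).  The moduli-membership clauses turning `(A ⊗ 𝔟, D_𝔟, λ′, η′)` into a
`PolarizedAbelianSchemeWithLevel g n δ X` — `exists_ample` of `λ′`, `HasType δ`, `IsSymplecticLiftable`, `IsOfRelDim g` — are organ (S1b) and are NOT in this file.

## Contents
* §1 (any base) `serreTranslate_comp_serreAction_i_eq_of_smul_eq` — (t2) from a column `P_b` with `E′P_b = P_b`, `N • P_b = b • P`;
  `exists_comp_serreAction_i_eq_of_mul_mem_span` — (t2) for `b·𝔞 ⊆ (N)` over a domain of characteristic `0`.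
* §2 (reduced locally Noetherian base) **`exists_serreTwist_cover_rows`** — THE HEAD: `∃ λ′ η′` with (t1)(t1′)(t2)(t3)(t4)(t5), `λ′` a homomorphism, `𝒪`-compatible,
  and unique among exact ones.

## References
* [RapoportSmithlingZhang2020Diagonal] M. Rapoport, B. Smithling, W. Zhang, *Arithmetic diagonal cycles on unitary Shimura varieties*, Compositio Math. 156 (2020),
  §3.2 (p. 11), §4.3 (4.23) (p. 21).
* [Conrad2004GrossZagier] B. Conrad, *Gross–Zagier revisited*, MSRI Publ. 49 (2004), §7 Thm. 7.5.
* [MumfordAV1970] D. Mumford, *Abelian Varieties* (1970), §7 Thm. 4 (p. 72), §23 Thm. 2 (p. 231).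
* [MilneCM2006] J. S. Milne, *Complex Multiplication* (2006), §7 (Def. 7.19, Prop. 7.22, Rem. 7.23).
* Tree: ★ `SerreTwistExactPolarizationExists`, ★ `SerreTwistPolarizationCompatible`, ★ `SerreTwistLevel`, ★ `SerrePresentationOfKernelLaw`,
  ★ `SerreTensorIdealTranslationKernel`, ★ `SerreTensorIdealTranslationQuasiInverse`, ★ `SerreTensorModuleMap`.
-/

set_option autoImplicit false

-- as the ★ Serre-tensor files: `Over`/`Scheme` wrappers and `Scheme.Modules` are semireducible
set_option backward.isDefEq.respectTransparency false

noncomputable section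

universe u

open CategoryTheory CategoryTheory.Limits AlgebraicGeometry MonoidalCategory CartesianMonoidalCategory
open scoped MonObj

namespace Literature.AlgebraicGeometry.AbelianSchemes

namespace AbelianSchemeOver

/-! ## §1 Row (t2): `ψ_P ≫ ι_𝔟(b) = ψ_{P_b} ≫ ι_𝔟(N)` for `N • P_b = b • P` -/

section RowT2

variable {S : Scheme.{u}} {A : AbelianSchemeOver S} {O : Type*} [CommRing O] (act : A.RingAction O) [IsCommMonObj A.X]
  {m : ℕ} (E' : Matrix (Fin m) (Fin m) O) (hE' : E' * E' = E') (P : Matrix (Fin m) (Fin 1) O) {N : ℕ}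

/-- `ψ_P ≫ ι_𝔟(b) = ψ_{b • P}`: translating by `P` then multiplying by `b` is translating by `b·P` (★ `serrePresentationHom_comp_of` with `P′ := b • E′`,
★ `serrePresentationHom_smul_self`). [cite: Conrad2004GrossZagier, §7 (Thm. 7.5)] -/
theorem serreTranslate_comp_serreAction_i (hP : E' * P = P) (b : O) :
    serreTranslate act E' hE' P ≫ (serreAction act E' hE').i b = serreTranslate act E' hE' (b • P) := by
  have hP1 : E' * P = P * (1 : Matrix (Fin 1) (Fin 1) O) := by rw [Matrix.mul_one]; exact hP
  have hbE : E' * (b • E') = (b • E') * E' := by rw [Matrix.mul_smul, Matrix.smul_mul, hE']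
  rw [serreTranslate, serreTranslate, Category.assoc, ← serrePresentationHom_smul_self act E' hE' b,
    serrePresentationHom_comp_of act (1 : Matrix (Fin 1) (Fin 1) O) one_mul_one_fin_one E' hE' E' hE' P hP1 (b • E') hbE,
    Matrix.smul_mul, hP]

/-- **Row (t2) from a column**: if `E′P_b = P_b` and `N • P_b = b • P` («`P_b ↔ b∕N ∈ 𝔞⁻¹`»), then `ψ_P ≫ ι_𝔟(b) = ψ_{P_b} ≫ ι_𝔟(N)`.
[cite: Conrad2004GrossZagier, §7 (Thm. 7.5)] [cite: MilneCM2006, §7 (Prop. 7.22)] -/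
theorem serreTranslate_comp_serreAction_i_eq_of_smul_eq (hP : E' * P = P) {b : O} (Pb : Matrix (Fin m) (Fin 1) O) (hPb : E' * Pb = Pb)
    (hNPb : (N : O) • Pb = b • P) :
    serreTranslate act E' hE' P ≫ (serreAction act E' hE').i b = serreTranslate act E' hE' Pb ≫ (serreAction act E' hE').i (N : O) := by
  rw [serreTranslate_comp_serreAction_i act E' hE' P hP, serreTranslate_comp_serreAction_i act E' hE' Pb hPb, hNPb]

/-- **Row (t2) for `b·𝔞 ⊆ (N)`** (`𝒪` a domain of characteristic `0`, `N ≠ 0`; `𝔞` generated by the coordinates of `P`): `∃ f : A → A ⊗ 𝔟` with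
`ψ_P ≫ ι_𝔟(b) = f ≫ ι_𝔟(N)` — in the CM model every `b ∈ 𝔞̄` qualifies since `𝔞𝔞̄ = (N)`. [cite: MilneCM2006, §7 (Prop. 7.22, Rem. 7.23)]
[cite: Conrad2004GrossZagier, §7 (Thm. 7.5)] -/
theorem exists_comp_serreAction_i_eq_of_mul_mem_span [IsDomain O] [CharZero O] (hN : N ≠ 0) (hP : E' * P = P) {b : O}
    (hb : ∀ k, b * P k 0 ∈ Ideal.span {(N : O)}) :
    ∃ f : A.X ⟶ (serreTensor act E' hE').X, IsMonHom f ∧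
      serreTranslate act E' hE' P ≫ (serreAction act E' hE').i b = f ≫ (serreAction act E' hE').i (N : O) := by
  classical
  -- `b · P_k = N · c_k`
  choose c hc using fun k => Ideal.mem_span_singleton'.mp (hb k)
  let Pb : Matrix (Fin m) (Fin 1) O := Matrix.of fun k _ => c k
  have hNPb : (N : O) • Pb = b • P := by
    ext k l
    change (N : O) * c k = b * P k l
    rw [Fin.fin_one_eq_zero l, mul_comm, hc]
  have hN' : (N : O) ≠ 0 := Nat.cast_ne_zero.mpr hN
  have hPb : E' * Pb = Pb := by
    apply smul_right_injective (Matrix (Fin m) (Fin 1) O) hN'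
    change (N : O) • (E' * Pb) = (N : O) • Pb
    rw [← Matrix.mul_smul, hNPb, Matrix.mul_smul, hP]
  exact ⟨serreTranslate act E' hE' Pb, isMonHom_serreTranslate act E' hE' Pb,
    serreTranslate_comp_serreAction_i_eq_of_smul_eq act E' hE' P hP Pb hPb hNPb⟩

end RowT2

/-! ## §2 The head: the twisted polarisation, the twisted level structure, and the six rows of the cover `ψ_P` -/

section Head

variable {S : Scheme.{u}} [IsReduced S] [IsLocallyNoetherian S] {A : AbelianSchemeOver S} {O : Type*} [CommRing O] (act : A.RingAction O)
  [IsCommMonObj A.X] {m : ℕ} (E' : Matrix (Fin m) (Fin m) O) (hE' : E' * E' = E') (P : Matrix (Fin m) (Fin 1) O) (Q : Matrix (Fin 1) (Fin m) O)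
  {N : ℕ} (D : A.DualPair) (Db : (serreTensor act E' hE').DualPair)
  (hD : Nonempty ((Scheme.Modules.pullback (DualPair.unitHatSlice D)).obj D.P ≅ SheafOfModules.unit _))
  (hDb : Nonempty ((Scheme.Modules.pullback (DualPair.unitHatSlice Db)).obj Db.P ≅ SheafOfModules.unit _))
  (pol : A.Polarization D) (σ : O → O)

/-- **THE SERRE-TWISTED FAMILY AND THE ROWS OF ITS COVER OVER THE BASE** ([RapoportSmithlingZhang2020Diagonal] (4.23) over `X`).  Base reduced and locally
Noetherian; `(E′, P, Q, N)` a Serre presentation of `𝔞⁻¹` with `N ≠ 0`, coordinates of `P` generating `𝔞`; a Rosati pair `1 − a ∈ 𝔞`, `b ∈ 𝔞`,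
`ι(a) ≫ λ = λ ≫ ι(b)^∨`; the Rosati law `ι(σ x) ≫ λ = λ ≫ ι(x)^∨`; a level-`n` structure `η` with `(N, n) = 1`; a dual pair `D_𝔟` of `A ⊗ 𝔟` with the unit pin; `𝒪` a
domain of characteristic `0` (for (t2)).  THEN there are a homomorphism `λ′ : A ⊗ 𝔟 → (A ⊗ 𝔟)^` and a level-`n` structure `η′` on `A ⊗ 𝔟` such that, for the cover
`c := ψ_P`: (t1) `∀ x ∈ 𝔞, ∃ d, c ≫ d = ι(x) ∧ d ≫ c = ι_𝔟(x)`; (t1′) `t ≫ c = 1 ↔ ∀ x ∈ 𝔞, t ≫ ι(x) = 1` on all `T`-points, and `c` is surjective; (t2) for every `y` with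
`y·𝔞 ⊆ (N)`, `∃ f, c ≫ ι_𝔟(y) = f ≫ ι_𝔟(N)`; (t3) `c ≫ λ′ ≫ c^∨ = λ ≫ [N]`; (t4) `ι(x) ≫ c = c ≫ ι_𝔟(x)`; (t5) `η′.σ i = η.σ i ≫ c`; moreover `λ′` satisfies the Rosati law
for `ι_𝔟` and is the unique exact homomorphism. [cite: RapoportSmithlingZhang2020Diagonal, §3.2 (p. 11) and §4.3 (4.23) (p. 21)] [cite: MumfordAV1970, §7 Thm. 4 (p. 72), §23 Thm. 2 (p. 231)]
[cite: Conrad2004GrossZagier, §7 (Thm. 7.5)] -/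
theorem exists_serreTwist_cover_rows [IsDomain O] [CharZero O] (hN : N ≠ 0) (hP : E' * P = P) (hQ : Q * E' = Q)
    (hQP : Q * P = Matrix.scalar (Fin 1) (N : O)) (hPQ : P * Q = Matrix.scalar (Fin m) (N : O) * E')
    {𝔞 : Ideal O} (h𝔞 : Ideal.span (Set.range fun k => P k 0) = 𝔞) {a b : O}
    (hab : haveI := act.isMonHom b; act.i a ≫ pol.lam = pol.lam ≫ DualPair.dualIsogenyOver (act.i b) D D)
    (ha : 1 - a ∈ 𝔞) (hb : b ∈ 𝔞) (hlam : ∀ x, act.i (σ x) ≫ pol.lam = pol.lam ≫ (act.dual D hD).i x)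
    {g n : ℕ} (lvl : A.LevelStructure g n) (hcop : Nat.Coprime N n) :
    ∃ (lam' : (serreTensor act E' hE').X ⟶ Db.hat.X) (_ : IsMonHom lam') (lvl' : (serreTensor act E' hE').LevelStructure g n),
      -- (t1) two-sided Serre presentation of `𝔞`
      (∀ x ∈ 𝔞, ∃ d : (serreTensor act E' hE').X ⟶ A.X, IsMonHom d ∧
        serreTranslate act E' hE' P ≫ d = act.i x ∧ d ≫ serreTranslate act E' hE' P = (serreAction act E' hE').i x) ∧
      -- (t1′) the kernel of the cover is the `𝔞`-torsion, on all `T`-points; the cover is surjective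
      (∀ ⦃T : Over S⦄ (t : T ⟶ A.X), t ≫ serreTranslate act E' hE' P = 1 ↔ ∀ x ∈ 𝔞, t ≫ act.i x = 1) ∧
      Function.Surjective (serreTranslate act E' hE' P).left.base ∧
      -- (t2) upper bound through `(N) ⊇ y·𝔞`
      (∀ y : O, (∀ x ∈ 𝔞, y * x ∈ Ideal.span {(N : O)}) → ∃ f : A.X ⟶ (serreTensor act E' hE').X, IsMonHom f ∧
        serreTranslate act E' hE' P ≫ (serreAction act E' hE').i y = f ≫ (serreAction act E' hE').i (N : O)) ∧
      -- (t3) polarisations: `c^* λ′ = N • λ`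
      (haveI := isMonHom_serreTranslate act E' hE' P
       serreTranslate act E' hE' P ≫ lam' ≫ DualPair.dualIsogenyOver (serreTranslate act E' hE' P) D Db = pol.lam ≫ D.hat.mulN N) ∧
      -- (t4) `𝒪`-equivariance of the cover
      (∀ x : O, act.i x ≫ serreTranslate act E' hE' P = serreTranslate act E' hE' P ≫ (serreAction act E' hE').i x) ∧
      -- (t5) level sections
      (∀ i, lvl'.σ i = lvl.σ i ≫ serreTranslate act E' hE' P) ∧
      -- Rosati law of `λ′` for `ι_𝔟`
      (∀ x : O, (serreAction act E' hE').i (σ x) ≫ lam' = lam' ≫ ((serreAction act E' hE').dual Db hDb).i x) ∧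
      -- uniqueness of the exact twisted polarisation
      (∀ lam'' : (serreTensor act E' hE').X ⟶ Db.hat.X, IsMonHom lam'' →
        (haveI := isMonHom_serreTranslate act E' hE' P
         serreTranslate act E' hE' P ≫ lam'' ≫ DualPair.dualIsogenyOver (serreTranslate act E' hE' P) D Db = pol.lam ≫ D.hat.mulN N) →
        lam'' = lam') := by
  -- (t3) the exact twisted polarisation from the Rosati pair
  obtain ⟨lam', hmon, hex, -⟩ :=
    exists_isExactTwistPol_of_rosatiPair act E' hE' P Q D Db hD hDb pol hN hP hQ hQP hPQ h𝔞 hab ha hb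
  haveI := hmon
  -- (t5) the twisted level structure
  obtain ⟨lvl', hlvl', -⟩ := lvl.existsUnique_serreTwist act E' hE' P Q hN hP hQ hQP hPQ hcop
  -- the coordinates of `P` lie in `𝔞`
  have hPmem : ∀ k, P k 0 ∈ 𝔞 := fun k => h𝔞 ▸ Ideal.subset_span ⟨k, rfl⟩
  haveI := surjective_serreTranslate_left act E' hE' P Q hN hP hQ hQP hPQ
  refine ⟨lam', hmon, lvl', ?_, ?_, ?_, ?_, ?_, ?_, hlvl', ?_, ?_⟩
  · -- (t1)
    intro x hx
    exact serreTranslate_twoSided_presentation act E' hE' P Q hN hP hQ hQP hPQ h𝔞 hx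
  · -- (t1′)
    intro T t
    exact comp_serreTranslate_eq_one_iff_forall_mem act E' hE' P hP h𝔞 t
  · -- surjectivity of the cover
    exact (serreTranslate act E' hE' P).left.surjective
  · -- (t2)
    intro y hy
    exact exists_comp_serreAction_i_eq_of_mul_mem_span act E' hE' P hN hP (fun k => hy _ (hPmem k))
  · -- (t3)
    exact (isExactTwistPol_iff act E' hE' P D Db pol N lam').mp hex
  · -- (t4)
    intro x
    exact i_comp_serreTranslate act E' hE' P hP x
  · -- Rosati law of `λ′`
    intro x
    exact serreAction_i_comp_of_isExactTwistPol act E' hE' P Q D Db hD hDb pol σ hN hP hQ hQP hPQ hlam (sq N).symm hex x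
  · -- uniqueness
    intro lam'' hmon'' h''
    haveI := hmon''
    exact IsExactTwistPol.eq act E' hE' P Q D Db hDb pol hN hP hQ hQP hPQ
      ((isExactTwistPol_iff act E' hE' P D Db pol N lam'').mpr h'') hex

end Head

/-! ## §3 (ED. 2, add-only) Row (t5) at EVERY level section `η.section_ a` (consumer ask LA5-p02 (g3) 06:03:40Z: `CoverKerE` (t5) reads `lvlPtEOf … a`) -/

section AllSections

variable {S : Scheme.{u}} {A : AbelianSchemeOver S} {O : Type*} [CommRing O] (act : A.RingAction O) [IsCommMonObj A.X]
  {m : ℕ} (E' : Matrix (Fin m) (Fin m) O) (hE' : E' * E' = E') (P : Matrix (Fin m) (Fin 1) O)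

/-- **Row (t5) for every `a : (ℤ/n)^{2g}`**: if the basis sections satisfy `η′.σ i = η.σ i ≫ ψ_P`, then `η′(a) = η(a) ≫ ψ_P` for EVERY `a` (Mumford's `σ^a`
commutes with post-composition by the homomorphism `ψ_P`, ★ `sectionPow_comp_of_isMonHom`). [cite: MumfordFogartyKirwan1994, Ch. 7 §1 Definition 7.1 (p. 129)]
[cite: RapoportSmithlingZhang2020Diagonal, §3.2 and (4.23)] -/
theorem LevelStructure.section_eq_section_comp_serreTranslate {g n : ℕ} {lvl : A.LevelStructure g n}
    {lvl' : (serreTensor act E' hE').LevelStructure g n} (h : ∀ i, lvl'.σ i = lvl.σ i ≫ serreTranslate act E' hE' P)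
    (a : Fin g ⊕ Fin g → ZMod n) :
    lvl'.section_ a = lvl.section_ a ≫ serreTranslate act E' hE' P := by
  haveI := isMonHom_serreTranslate act E' hE' P
  have hσ : lvl'.σ = fun i => lvl.σ i ≫ serreTranslate act E' hE' P := funext h
  change (serreTensor act E' hE').sectionPow lvl'.σ a = A.sectionPow lvl.σ a ≫ serreTranslate act E' hE' P
  rw [sectionPow_comp_of_isMonHom, hσ]

end AllSections

end AbelianSchemeOver

end Literature.AlgebraicGeometry.AbelianSchemes

end
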